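import Literature.NumberTheory.ComplexMultiplication.ArtinLiftVersusArtinCorrespondent
import Literature.NumberTheory.ComplexMultiplication.MainTheoremCMOverField
import HarnessLib

/-!
# The main theorem of complex multiplication in Milne's finite-idèle currency «`art_E(t) = σ|E^ab`»
# over a general number field `E ⊇ K*` ([Shimura 1998] Thm. 18.6; [Milne 2005] (59), Thm. 11.2, (62))

Theorems only (topic `NumberTheory/ComplexMultiplication`; no definition, no named fact, no instance).

The tree states reciprocity in two conventions: Shimura's «`σ = [s, E]` on `E_ab`» for a FULL idèle `s`
(`IsArtinLift E s σ`, the binder of `shimura1998_thm18_6`; arithmetic normalisation) and Milne's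
«`art_E(t) = σ|E^ab`» for a FINITE idèle `t` (`UnitaryCanonicalModel.IsArtinCorrespondent E τ t σ`, the binder
of `SiegelRationalModel.IsCanonical` and of the unitary canonical-model facts; `art = rec⁻¹`, geometric
normalisation).  The adapter `isArtinCorrespondent_iff_isArtinLift` of `ArtinLiftVersusArtinCorrespondent` is
typed for a CM field; but the field `E ⊇ ∏ E*(Φᵢ)` of [Deligne 1971] 4.18 / [Milne 2005] (62) over which
`SiegelRationalModel.IsCanonical` quantifies is an ARBITRARY number field inside `ℂ`.  §1 records the
finite-idèle adapter for any number field `M ⊂ ℂ` (the CM hypothesis of the tree's lemma is idle: both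
predicates and `finiteIdeleClass` need only `[NumberField M]`), and §2 reads [Shimura 1998, Thm. 18.6]
(granted as the binder `h186`) directly in the `IsCanonical` currency: for `E : IntermediateField ℚ ℂ` with
`traceField Φ ≤ E`, `σ ∈ Aut(ℂ/E)`, a finite idèle `t` of `E` with `art_E(t) = σ|E^ab`, there is a
uniformisation `ξ′` of `(A^σ, ι^σ)` of type `(K, Φ, g(N_{E/K*}(1_∞, t))·𝔞)` — Milne's sign, NO inverse
(Shimura's `s` is Milne's `t⁻¹`: [Milne 2005] Thm. 11.2 vs [Shimura 1998] Thm. 18.6) — with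
`ξ(q(u))^σ = ξ′(q(v))` whenever `g(N_{E/K*}(1_∞, t)) · (u mod 𝔞) = v`; and the family form over
`E ⊇ E*(Φᵢ)` for all `i` (CM-algebra special pairs, `F = ∏ Kᵢ`).

* `isArtinCorrespondent_algebraMap_iff_exists_ringHom`, `isArtinCorrespondent_algebraMap_iff_isArtinLift`
  (§1, any number field `M ⊂ ℂ`).
* `shimura1998_thm18_6_of_isArtinCorrespondent`, `shimura1998_thm18_6_family_of_isArtinCorrespondent` (§2).

The bridge between the full-idèle norm used here (`ideleRelNorm`) and the finite-idèle norm of the Siegel-side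
bookkeeping (`finiteIdeleRelNorm`, `SiegelCanonicalReciprocityBaseField`) is the tree's
`AdelicBaseChange.finitePart_ideleRelNorm` («`(N_{L/K} s)_𝐡 = N_{L/K}(s_𝐡)`»).

## References

* [Shimura1998] G. Shimura, *Abelian Varieties with Complex Multiplication and Modular Functions*
  (1998), §18.3 p. 122 («[a, M]»); §18.6 Thm. 18.6 (1)–(2) pp. 124–125; §21.4, proof of Thm. 21.4, p. 147.
* [Milne2005ShimuraVarieties] J. S. Milne, *Introduction to Shimura Varieties* (2005), (59) p. 107
  («art_E(α) = rec_E(α)⁻¹»), Thm. 11.2 p. 108, Def. 12.8 (62) p. 114.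
* [Deligne1971TravauxShimura] P. Deligne, *Travaux de Shimura*, 4.18–4.21 pp. 150–152.
-/

noncomputable section

open scoped Classical nonZeroDivisors NumberField
open CategoryTheory NumberField IsDedekindDomain

namespace Literature.NumberTheory.ComplexMultiplication

open Literature.AlgebraicGeometry.Motives (CMType AbelianVariety)
open Literature.NumberTheory.GaloisRepresentations (ideleGroup absGaloisAbProj isGlobalReciprocitySystem_artinMap)
open Literature.NumberTheory.NumberFields (ideleArtinMap)
open Literature.NumberTheory.NumberFields.IdeleAction (ideleMulEquiv)
open Literature.NumberTheory.AdelicBaseChange (ideleRelNorm)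
open Literature.AlgebraicGeometry.ShimuraVarieties.UnitaryCanonicalModel (IsArtinCorrespondent finiteIdeleClass)

/-! ## §1 The finite-idèle adapter for any number field `M ⊂ ℂ` -/

section Adapter

variable {M : Type} [Field M] [NumberField M] [Algebra M ℂ]

/-- **`IsArtinCorrespondent` along `algebraMap M ℂ` without the `M`-algebra packaging, for ANY number field
`M ⊂ ℂ`**: `σ` and the finite idèle `t` correspond under Milne's `art_M` iff for some ring homomorphism
`f : M̄ → ℂ` extending `M ⊂ ℂ` and some `γ ∈ Gal(M̄/M)` with `f ∘ γ = σ ∘ f`, the class of `γ` in `Gal(M̄/M)^ab` is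
`θ_M((1_∞, t) mod M^×)⁻¹` (the tree's `isArtinCorrespondent_iff_exists_ringHom` with its idle CM binder dropped;
the `M`-algebra structure `(algebraMap M ℂ).toAlgebra` installed by the predicate and the given one have the
same `algebraMap`, which is all an `M`-algebra homomorphism `M̄ →ₐ[M] ℂ` records).
[cite: Milne2005ShimuraVarieties, (59) p. 107 («art_E(α) = rec_E(α)⁻¹»)] -/
theorem isArtinCorrespondent_algebraMap_iff_exists_ringHom (t : (FiniteAdeleRing (𝓞 M) M)ˣ) (σ : ℂ ≃+* ℂ) :
    IsArtinCorrespondent M (algebraMap M ℂ) t σ ↔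
      ∃ f : AlgebraicClosure M →+* ℂ, f.comp (algebraMap M (AlgebraicClosure M)) = algebraMap M ℂ ∧
        ∃ γ : Field.absoluteGaloisGroup M,
          (∀ x : AlgebraicClosure M, f (Field.absoluteGaloisGroup.toAlgEquiv M γ x) = σ (f x)) ∧
            absGaloisAbProj M γ = ((isGlobalReciprocitySystem_artinMap M).theta (finiteIdeleClass M t))⁻¹ := by
  unfold IsArtinCorrespondent
  constructor
  · rintro ⟨e, γ, he, hγ⟩
    letI : Algebra M ℂ := (algebraMap M ℂ).toAlgebra
    exact ⟨(e : AlgebraicClosure M →+* ℂ), e.comp_algebraMap, γ, he, hγ⟩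
  · rintro ⟨f, hf, γ, he, hγ⟩
    exact ⟨@AlgHom.mk M (AlgebraicClosure M) ℂ _ _ _ _ (algebraMap M ℂ).toAlgebra f
      (fun r => RingHom.congr_fun hf r), γ, he, hγ⟩

/-- **Milne's correspondent of `σ` is Shimura's, inverted — for ANY number field `M ⊂ ℂ`** (finite-idèle form):
for a finite idèle `t` of `M` and `σ ∈ Aut(ℂ/M)`, `IsArtinCorrespondent M (M ⊂ ℂ) t σ` («`art_M(t) = σ|M^ab`»,
`art = rec⁻¹`) iff `IsArtinLift M (1_∞, t)⁻¹ σ` («`σ = [(1_∞, t)⁻¹, M]` on `M_ab`»): `θ_M(t̄)⁻¹ = θ_M(t̄⁻¹) =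
[(1_∞, t)⁻¹, M]`.  The tree's `isArtinCorrespondent_iff_isArtinLift` is this statement with an additional (idle)
`[IsCMField M]` binder; the CM-free form is the one `SiegelRationalModel.IsCanonical` needs (`E ⊇ ∏ E*(Φᵢ)` is any
number field). [cite: Milne2005ShimuraVarieties, (59) p. 107; Thm. 11.2 p. 108] [cite: Shimura1998, §18.3 p. 122; §18.6 Thm. 18.6 pp. 124–125] -/
theorem isArtinCorrespondent_algebraMap_iff_isArtinLift (t : (FiniteAdeleRing (𝓞 M) M)ˣ) (σ : ℂ ≃ₐ[M] ℂ) :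
    IsArtinCorrespondent M (algebraMap M ℂ) t σ.toRingEquiv ↔ IsArtinLift M (finiteIdeles M t)⁻¹ σ := by
  rw [isArtinCorrespondent_algebraMap_iff_exists_ringHom, isArtinLift_iff_exists_ringHom, map_inv]
  simp only [AlgEquiv.coe_ringEquiv]
  rfl

end Adapter

/-! ## §2 [Shimura 1998, Thm. 18.6] in the `IsCanonical` currency: `E : IntermediateField ℚ ℂ`, finite idèle, `art_E` -/

/-- **[Shimura 1998, Thm. 18.6] for `σ ∈ Aut(ℂ/E)` and a finite idèle `t` of a number field `E ⊇ K*` with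
`art_E(t) = σ|E^ab`** ([Milne 2005] Thm. 11.2 / (62) currency).  Granted the main theorem (`h186`): for
`E : IntermediateField ℚ ℂ` with `traceField Φ ≤ E`, a structure `(A, ι, ξ)` of type `(K, Φ, 𝔞)`, `σ : ℂ ≃ₐ[E] ℂ`
and `t ∈ 𝔸_{E,f}^×` with `IsArtinCorrespondent E (E ⊂ ℂ) t σ`, there is a uniformisation `ξ′` of `(A^σ, ι^σ)` of
type `(K, Φ, g(N_{E/K*}(1_∞, t))·𝔞)` — Milne's sign: Shimura's `s = N_{E/K*}((1_∞, t)⁻¹)`, so `g(s)⁻¹𝔞 =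
g(N_{E/K*}(1_∞, t))𝔞` — such that `ξ(q(u))^σ = ξ′(q(v))` whenever `g(N_{E/K*}(1_∞, t))·(u mod 𝔞) = v` (18.3a).
Proof: §1 adapter, `shimura1998_thm18_6_of_le` at `y = (1_∞, t)⁻¹`, and `map_inv`/`inv_inv` on the monoid
homomorphisms `ideleRelNorm`, `reflexNormFinitePart`. [cite: Shimura1998, §18.6 Thm. 18.6 (1)–(2) pp. 124–125; §21.4, proof of Thm. 21.4, p. 147]
[cite: Milne2005ShimuraVarieties, Thm. 11.2 p. 108; Def. 12.8 (62) p. 114] -/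
theorem shimura1998_thm18_6_of_isArtinCorrespondent (h186 : shimura1998_thm18_6)
    (K : Type) [Field K] [NumberField K] [IsCMField K] (Φ : CMType K) [NumberField (traceField Φ)]
    (E : IntermediateField ℚ ℂ) [NumberField E] (hE : traceField Φ ≤ E)
    (𝔞 : (FractionalIdeal (𝓞 K)⁰ K)ˣ) (A : AbelianVariety ℂ) (ι : 𝓞 K →+* End A)
    (ξ : CMTypeUniformization Φ 𝔞 A ι) (σ : ℂ ≃ₐ[E] ℂ) (t : (FiniteAdeleRing (𝓞 E) E)ˣ)
    (ht : IsArtinCorrespondent E (algebraMap E ℂ) t σ.toRingEquiv) :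
    letI : Algebra (traceField Φ) E := (IntermediateField.inclusion hE).toRingHom.toAlgebra
    ∃ ξ' : CMTypeUniformization Φ
        (ideleMulIdealUnits
          (reflexNormFinitePart K Φ (traceField Φ) (ideleRelNorm (traceField Φ) E (finiteIdeles E t))) 𝔞)
        (A.conjugate σ.toRingEquiv) ((A.endConjugate σ.toRingEquiv).comp ι),
      ∀ u v : K,
        ideleMulEquiv (reflexNormFinitePart K Φ (traceField Φ) (ideleRelNorm (traceField Φ) E (finiteIdeles E t)))
            (𝔞 : FractionalIdeal (𝓞 K)⁰ K) 𝔞.ne_zero (Submodule.Quotient.mk u) = Submodule.Quotient.mk v →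
          A.conjPoints σ.toRingEquiv (ξ.r u) = ξ'.r v := by
  have key := shimura1998_thm18_6_of_le h186 K Φ E hE 𝔞 A ι ξ σ (finiteIdeles E t)⁻¹
    ((isArtinCorrespondent_algebraMap_iff_isArtinLift t σ).mp ht)
  rw [map_inv, map_inv, inv_inv] at key
  exact key

/-- **[Shimura 1998, Thm. 18.6] for a family of structures over `E ⊇ E*(Φᵢ)`, in the `IsCanonical` currency**
(`E : IntermediateField ℚ ℂ`, `∀ i, traceField (Φ i) ≤ E`, `σ : ℂ ≃ₐ[E] ℂ`, finite idèle `t` with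
`art_E(t) = σ|E^ab`): uniformisations `ξ′ᵢ` of `(Aᵢ^σ, ιᵢ^σ)` of types `(Kᵢ, Φᵢ, gᵢ(N_{E/K*ᵢ}(1_∞, t))·𝔞ᵢ)` with the
(18.3a) torsion clause, for every `i` — the component-wise input of the CM-algebra special pairs `F = ∏ Kᵢ` of
[Deligne 1971] 4.18. [cite: Shimura1998, §18.6 Thm. 18.6 (1)–(2) pp. 124–125] [cite: Milne2005ShimuraVarieties, Def. 12.8 (62) p. 114]
[cite: Deligne1971TravauxShimura, 4.18 p. 150] -/
theorem shimura1998_thm18_6_family_of_isArtinCorrespondent (h186 : shimura1998_thm18_6)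
    {I : Type} (K : I → Type) [∀ i, Field (K i)] [∀ i, NumberField (K i)] [∀ i, IsCMField (K i)]
    (Φ : ∀ i, CMType (K i)) [∀ i, NumberField (traceField (Φ i))]
    (E : IntermediateField ℚ ℂ) [NumberField E] (hE : ∀ i, traceField (Φ i) ≤ E)
    (𝔞 : ∀ i, (FractionalIdeal (𝓞 (K i))⁰ (K i))ˣ) (A : I → AbelianVariety ℂ)
    (ιA : ∀ i, 𝓞 (K i) →+* End (A i)) (ξ : ∀ i, CMTypeUniformization (Φ i) (𝔞 i) (A i) (ιA i))
    (σ : ℂ ≃ₐ[E] ℂ) (t : (FiniteAdeleRing (𝓞 E) E)ˣ)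
    (ht : IsArtinCorrespondent E (algebraMap E ℂ) t σ.toRingEquiv) :
    letI : ∀ i, Algebra (traceField (Φ i)) E := fun i =>
      (IntermediateField.inclusion (hE i)).toRingHom.toAlgebra
    ∃ ξ' : ∀ i, CMTypeUniformization (Φ i)
        (ideleMulIdealUnits
          (reflexNormFinitePart (K i) (Φ i) (traceField (Φ i))
            (ideleRelNorm (traceField (Φ i)) E (finiteIdeles E t))) (𝔞 i))
        ((A i).conjugate σ.toRingEquiv) (((A i).endConjugate σ.toRingEquiv).comp (ιA i)),
      ∀ (i : I) (u v : K i),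
        ideleMulEquiv
            (reflexNormFinitePart (K i) (Φ i) (traceField (Φ i))
              (ideleRelNorm (traceField (Φ i)) E (finiteIdeles E t)))
            (𝔞 i : FractionalIdeal (𝓞 (K i))⁰ (K i)) (𝔞 i).ne_zero (Submodule.Quotient.mk u) =
            Submodule.Quotient.mk v →
          (A i).conjPoints σ.toRingEquiv ((ξ i).r u) = (ξ' i).r v := by
  choose ξ' hξ' using fun i =>
    shimura1998_thm18_6_of_isArtinCorrespondent h186 (K i) (Φ i) E (hE i) (𝔞 i) (A i) (ιA i) (ξ i) σ t ht
  exact ⟨ξ', hξ'⟩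

end Literature.NumberTheory.ComplexMultiplication

end
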